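import Literature.MathematicalPhysics.QuantumFieldTheory.QCDOS
import Literature.MathematicalPhysics.QuantumLattice.GrassmannWardIdentity
import Literature.MathematicalPhysics.QuantumLattice.GrassmannIntegralPartialShift
import HarnessLib

/-!
# Ward calculus for the slab flux bound: Berezin integration by parts, the substitution derivation, and the
# objects of the twisted doublet (file 1/4 of stub `stub_slabFluxBound`, line `Sketch` of crux
# `Summit.QuantumFields.QCD.Theses.EulerDescent.ChiralCornerSoftness`, item stmt-QuantumFields-16902)

§A — generic finite-dimensional Grassmann calculus over a commutative ring `R` (generators indexed by a
finite `Γ`), the engine of the exact lattice Ward identity proved in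
`EulerDescentChiralCornerSoftnessStubSlabFluxBound.lean`:

* the left derivative lowers the degree (`grassmannDeriv_mem_exteriorPower`), hence the Berezin integral of a
  derivative vanishes (`berezin_grassmannDeriv` — Berezin integration by parts) and `∫ θ_X ∂_Y a = δ_{XY} ∫ a`
  (`berezin_gen_mul_grassmannDeriv`);
* the **substitution derivation** `subOp N = δ_N = Σ_{X,Y} N(X,Y) θ_X ∂_Y` (the infinitesimal form of the linear
  substitution `θ_Y ↦ θ_Y + ε Σ_X N(X,Y) θ_X`) is an even derivation (`subOp_mul`), changes the Berezin
  integral by the trace, `∫ ∘ δ_N = (tr N) ∫` (`berezin_subOp` — the infinitesimal fermionic Jacobian), and acts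
  on the exponential of a nilpotent `q` commuting with `δ_N q` by `δ_N e^q = e^q δ_N q` (`subOp_grassmannExp`);
* the **Schwinger–Dyson identity** `∫ (δ_N X) e^q + ∫ X e^q (δ_N q) = 0` for traceless `N`
  (`berezin_subOp_mul_grassmannExp_add`).

§Defs — the objects on the torus quark algebra `FermiAlg N_f L` of `QCDOS` used by the three sequel files:
`quadQ M = Σ_{v,w} M_{vw} ψ̄_v ψ_w` (the un-enumerated `quadratic`), the bilinear kernel `bilinKernel`, the label
matrix `wardN B` and the **Ward operator** `wardOp B = subOp (wardN B)` of the rotation `ψ ↦ (1+εB)ψ`,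
`ψ̄ ↦ ψ̄(1−εB)`; the doublet matrices `tau1M`, `tau2M` (`τ¹ = E_fg + E_gf`, `τ² = −iE_fg + iE_gf`), `twSign` (`τ³`),
`flavDiag`, the degenerate-mass Wilson–Dirac matrix `diracQ`, the twisted mass `twistQ` (verbatim the body of the
statement's `Tw`), `twistBlock`, the time-sliced rotation generator `rotQ f g b = b(x₀) τ²`, the kernels `densQ`
of `P¹(x) = ψ̄(x)γ₅τ¹ψ(x)` and `currQ` of the conserved point-split current `Ṽ²₀(x)`, and the slab-complement
indicator `slabInd`.

References: F. A. Berezin, *The Method of Second Quantization* (1966), Ch. I §3; M. Salmhofer,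
*Renormalization* (1999), App. B.2; I. Montvay, G. Münster, *Quantum Fields on a Lattice* (1994), §5.3.1
(5.149)–(5.150); R. Frezzotti, P. A. Grassi, S. Sint, P. Weisz, JHEP 08 (2001) 058, §2.1.  Everything is proved;
no named fact.
-/

noncomputable section

namespace Summit.QuantumFields.QCD.Cruxes.ChiralCornerSoftness.TwistedRay

open Literature.MathematicalPhysics.QuantumLattice

namespace SlabFluxWard

open Literature.MathematicalPhysics.QuantumLattice.GrassmannAlgebra

/-! ### §A Generic Grassmann calculus: Berezin integration by parts and the substitution derivation -/

section Generic

variable {R : Type*} [CommRing R] {Γ : Type*} [DecidableEq Γ]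

omit [DecidableEq Γ] in
/-- Scalars have zero left derivative. [folklore] -/
theorem grassmannDeriv_eq_zero_of_mem_exteriorPower_zero (Y : Γ) {z : GrassmannAlgebra R Γ}
    (hz : z ∈ ⋀[R]^0 (Γ → R)) : grassmannDeriv R Y z = 0 := by
  rw [ExteriorAlgebra.exteriorPower, pow_zero, Submodule.mem_one] at hz
  obtain ⟨r, rfl⟩ := hz
  exact grassmannDeriv_algebraMap R Y r

omit [DecidableEq Γ] in
/-- The left derivative lowers the degree by one: `∂_Y ⋀^{k+1} ⊆ ⋀^k`. [folklore] -/
theorem grassmannDeriv_mem_exteriorPower (Y : Γ) :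
    ∀ (k : ℕ) {z : GrassmannAlgebra R Γ}, z ∈ ⋀[R]^(k + 1) (Γ → R) →
      grassmannDeriv R Y z ∈ ⋀[R]^k (Γ → R) := by
  intro k
  induction k with
  | zero =>
    intro z hz
    rw [ExteriorAlgebra.exteriorPower, zero_add, pow_one] at hz
    obtain ⟨v, rfl⟩ := LinearMap.mem_range.1 hz
    rw [grassmannDeriv_ι, ExteriorAlgebra.exteriorPower, pow_zero]
    exact Submodule.mem_one.2 ⟨_, rfl⟩
  | succ k ih =>
    intro z hz
    rw [ExteriorAlgebra.exteriorPower, pow_succ'] at hz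
    refine Submodule.mul_induction_on hz (fun m hm n hn => ?_) (fun x y hx hy => ?_)
    · obtain ⟨v, rfl⟩ := LinearMap.mem_range.1 hm
      rw [grassmannDeriv_ι_mul]
      refine Submodule.sub_mem _ (Submodule.smul_mem _ _ hn) ?_
      rw [ExteriorAlgebra.exteriorPower, pow_succ']
      exact Submodule.mul_mem_mul hm (ih hn)
    · rw [map_add]
      exact Submodule.add_mem _ hx hy

variable [Fintype Γ]

section Berezin

variable [LinearOrder Γ]

omit [DecidableEq Γ] in
/-- **Berezin integration by parts**: the Berezin integral of a left derivative vanishes. [folklore] -/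
theorem berezin_grassmannDeriv (Y : Γ) (x : GrassmannAlgebra R Γ) :
    berezin R Γ (grassmannDeriv R Y x) = 0 := by
  conv_lhs => rw [← (grassmannBasis R Γ).sum_repr x]
  rw [map_sum, map_sum]
  refine Finset.sum_eq_zero fun s _ => ?_
  rw [map_smul, map_smul, smul_eq_mul]
  refine mul_eq_zero_of_right _ ?_
  have hs := grassmannBasis_mem_exteriorPower R s
  obtain ⟨n, hn⟩ : ∃ n, s.card = n := ⟨_, rfl⟩
  rw [hn] at hs
  cases n with
  | zero => rw [grassmannDeriv_eq_zero_of_mem_exteriorPower_zero Y hs, map_zero]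
  | succ n =>
    have hle : s.card ≤ Fintype.card Γ := s.card_le_univ
    exact berezin_eq_zero_of_mem_exteriorPower R (by omega) (grassmannDeriv_mem_exteriorPower Y n hs)

/-- `∫ θ_X ∂_Y a = δ_{XY} ∫ a`. [folklore] -/
theorem berezin_gen_mul_grassmannDeriv (X Y : Γ) (a : GrassmannAlgebra R Γ) :
    berezin R Γ (gen R X * grassmannDeriv R Y a) = if Y = X then berezin R Γ a else 0 := by
  have h' : gen R X * grassmannDeriv R Y a =
      (if Y = X then a else 0) - grassmannDeriv R Y (gen R X * a) := by
    rw [grassmannDeriv_gen_mul]; abel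
  rw [h', map_sub, berezin_grassmannDeriv, sub_zero]
  split_ifs <;> simp

end Berezin

omit [Fintype Γ] in
/-- `θ_X ∂_Y` is an (even) derivation. [folklore] -/
theorem gen_mul_grassmannDeriv_mul (X Y : Γ) (a b : GrassmannAlgebra R Γ) :
    gen R X * grassmannDeriv R Y (a * b) =
      gen R X * grassmannDeriv R Y a * b + a * (gen R X * grassmannDeriv R Y b) := by
  have hc : gen R X * CliffordAlgebra.involute a = a * gen R X := by
    have h := ι_mul_eq_involute_mul_ι (R := R) (Pi.single X (1 : R)) (CliffordAlgebra.involute a)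
    rw [CliffordAlgebra.involute_involute] at h
    exact h
  rw [grassmannDeriv_mul, mul_add, ← mul_assoc, ← mul_assoc, hc]
  simp only [mul_assoc]

/-- The **substitution derivation** `δ_N = Σ_{X,Y} N(X,Y) θ_X ∂_Y` (infinitesimal linear substitution
`θ_Y ↦ θ_Y + ε Σ_X N(X,Y) θ_X`). [folklore] -/
def subOp (N : Γ → Γ → R) : GrassmannAlgebra R Γ →ₗ[R] GrassmannAlgebra R Γ :=
  ∑ X, ∑ Y, N X Y • (LinearMap.mulLeft R (gen R X) ∘ₗ grassmannDeriv R Y)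

/-- Unfolding `subOp`. [folklore] -/
theorem subOp_apply (N : Γ → Γ → R) (a : GrassmannAlgebra R Γ) :
    subOp N a = ∑ X, ∑ Y, N X Y • (gen R X * grassmannDeriv R Y a) := by
  simp [subOp, LinearMap.mulLeft_apply]

/-- The substitution derivation on a generator: `δ_N θ_Z = Σ_X N(X,Z) θ_X`. [folklore] -/
theorem subOp_gen (N : Γ → Γ → R) (Z : Γ) : subOp N (gen R Z) = ∑ X, N X Z • gen R X := by
  rw [subOp_apply]
  refine Finset.sum_congr rfl fun X _ => ?_
  simp only [grassmannDeriv_gen, mul_ite, mul_one, mul_zero, smul_ite, smul_zero, Finset.sum_ite_eq',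
    Finset.mem_univ, if_true]

/-- The substitution derivation is a derivation. [folklore] -/
theorem subOp_mul (N : Γ → Γ → R) (a b : GrassmannAlgebra R Γ) :
    subOp N (a * b) = subOp N a * b + a * subOp N b := by
  simp only [subOp_apply, gen_mul_grassmannDeriv_mul, smul_add, Finset.sum_add_distrib, Finset.sum_mul,
    Finset.mul_sum, smul_mul_assoc, mul_smul_comm]

/-- The substitution derivation kills `1`. [folklore] -/
theorem subOp_one (N : Γ → Γ → R) : subOp N (1 : GrassmannAlgebra R Γ) = 0 := by
  simp [subOp_apply]

/-- **`∫ ∘ δ_N = (tr N) · ∫`**: the infinitesimal Berezin change of variables. [cite: Berezin1966, Ch. I §3] -/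
theorem berezin_subOp [LinearOrder Γ] (N : Γ → Γ → R) (a : GrassmannAlgebra R Γ) :
    berezin R Γ (subOp N a) = (∑ X, N X X) * berezin R Γ a := by
  rw [subOp_apply, map_sum, Finset.sum_mul]
  refine Finset.sum_congr rfl fun X _ => ?_
  simp only [map_sum, map_smul, berezin_gen_mul_grassmannDeriv, smul_eq_mul, mul_ite, mul_zero,
    Finset.sum_ite_eq', Finset.mem_univ, if_true]

/-- The derivation on powers of an element commuting with its image. [folklore] -/
theorem subOp_pow_succ (N : Γ → Γ → R) {q : GrassmannAlgebra R Γ} (hq : Commute q (subOp N q)) (n : ℕ) :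
    subOp N (q ^ (n + 1)) = (n + 1) • (q ^ n * subOp N q) := by
  induction n with
  | zero => simp
  | succ n ih =>
    rw [pow_succ', subOp_mul, ih, mul_smul_comm, ← mul_assoc, ← pow_succ', ← (hq.pow_left (n + 1)).eq,
      add_comm, ← succ_nsmul]

variable [Algebra ℚ R]

omit [DecidableEq Γ] [Fintype Γ] in
/-- Factorial bookkeeping: `((m+1)!)⁻¹ (m+1) x = (m!)⁻¹ x`. [folklore] -/
theorem inv_factorial_succ_smul_succ_nsmul (m : ℕ) (x : GrassmannAlgebra R Γ) :
    (((m + 1).factorial : ℚ)⁻¹) • ((m + 1) • x) = ((m.factorial : ℚ)⁻¹) • x := by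
  rw [← Nat.cast_smul_eq_nsmul ℚ (m + 1) x, smul_smul]
  congr 1
  rw [Nat.factorial_succ]
  push_cast
  field_simp

/-- **The derivation on the exponential** of a nilpotent element commuting with its image:
`δ(e^q) = e^q δq`. [folklore] -/
theorem subOp_grassmannExp (N : Γ → Γ → R) {q : GrassmannAlgebra R Γ} (hq : Commute q (subOp N q))
    (hn : IsNilpotent q) : subOp N (grassmannExp q) = grassmannExp q * subOp N q := by
  obtain ⟨K, hK⟩ := hn
  have hK1 : q ^ (K + 1) = 0 := by rw [pow_succ, hK, zero_mul]
  conv_lhs => rw [grassmannExp, IsNilpotent.exp_eq_sum hK1, map_sum, Finset.sum_range_succ']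
  conv_rhs => rw [grassmannExp, IsNilpotent.exp_eq_sum hK, Finset.sum_mul]
  simp only [pow_zero, Nat.factorial_zero, Nat.cast_one, inv_one, one_smul, subOp_one, add_zero,
    LinearMap.map_smul_of_tower, subOp_pow_succ N hq, inv_factorial_succ_smul_succ_nsmul, smul_mul_assoc]

/-- **Schwinger–Dyson / Ward identity of the Berezin integral**: for a TRACELESS substitution
derivation `δ` and a nilpotent weight exponent `q` commuting with `δq`,
`∫ (δX) e^q + ∫ X (e^q δq) = 0`. [folklore] -/
theorem berezin_subOp_mul_grassmannExp_add [LinearOrder Γ] (N : Γ → Γ → R) (hN : ∑ X, N X X = 0)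
    {q : GrassmannAlgebra R Γ} (hq : Commute q (subOp N q)) (hn : IsNilpotent q) (X : GrassmannAlgebra R Γ) :
    berezin R Γ (subOp N X * grassmannExp q) + berezin R Γ (X * (grassmannExp q * subOp N q)) = 0 := by
  have h0 : berezin R Γ (subOp N (X * grassmannExp q)) = 0 := by rw [berezin_subOp, hN, zero_mul]
  rwa [subOp_mul, subOp_grassmannExp N hq ⟨_, hn.choose_spec⟩, map_add] at h0

end Generic


/-! ### §Defs The objects of the twisted doublet on the torus quark algebra -/

section Defs

open Literature.MathematicalPhysics.QuantumFieldTheory Literature.Probability.LatticeModels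

variable {Nf L : ℕ} [NeZero L]

/-- The quadratic action `ψ̄ M ψ` of a matrix indexed by quark variables (flavour, site, colour, spin). [folklore] -/
def quadQ (M : Matrix (QuarkVar Nf L) (QuarkVar Nf L) ℂ) : FermiAlg Nf L :=
  quadratic ℂ (Matrix.reindex quarkEquiv quarkEquiv M)

/-- Kernel of the torus bilinear `ψ̄_f(x) Γ M ψ_g(y)`. [folklore] -/
def bilinKernel (f g : Fin Nf) (x y : TorusSite 4 L) (Γs : Matrix (Fin 4) (Fin 4) ℂ)
    (Mc : Matrix (Fin 3) (Fin 3) ℂ) : Matrix (QuarkVar Nf L) (QuarkVar Nf L) ℂ :=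
  Matrix.of fun v w =>
    if v.1 = f ∧ v.2.1 = x ∧ w.1 = g ∧ w.2.1 = y then Γs v.2.2.2 w.2.2.2 * Mc v.2.2.1 w.2.2.1 else 0

/-- The label matrix of the substitution derivation: `−B` on the `ψ̄` block (columns), `Bᵀ` on the
`ψ` block. [folklore] -/
def wardN (B : Matrix (QuarkVar Nf L) (QuarkVar Nf L) ℂ) (X Y : FermiIdx Nf L ⊕ₗ FermiIdx Nf L) : ℂ :=
  match ofLex X, ofLex Y with
  | Sum.inl i, Sum.inl k => -B (quarkEquiv.symm i) (quarkEquiv.symm k)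
  | Sum.inr i, Sum.inr l => B (quarkEquiv.symm l) (quarkEquiv.symm i)
  | Sum.inl _, Sum.inr _ => 0
  | Sum.inr _, Sum.inl _ => 0

/-- The Ward operator (even derivation of the torus quark Grassmann algebra). [folklore] -/
def wardOp (B : Matrix (QuarkVar Nf L) (QuarkVar Nf L) ℂ) : FermiAlg Nf L →ₗ[ℂ] FermiAlg Nf L :=
  subOp (wardN B)



/-- `τ¹ = E_fg + E_gf` on the doublet `(f,g)`. [folklore] -/
def tau1M (f g : Fin Nf) : Matrix (Fin Nf) (Fin Nf) ℂ := Matrix.single f g 1 + Matrix.single g f 1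

/-- `τ² = −iE_fg + iE_gf` on the doublet `(f,g)`. [folklore] -/
def tau2M (f g : Fin Nf) : Matrix (Fin Nf) (Fin Nf) ℂ :=
  (-Complex.I) • Matrix.single f g 1 + Complex.I • Matrix.single g f 1

/-- The sign of the twisted mass on flavour `f'`: `+1` on `f`, `−1` on `g`, `0` elsewhere. [folklore] -/
def twSign (f g : Fin Nf) (f' : Fin Nf) : ℂ := if f' = f then 1 else if f' = g then -1 else 0

/-- A flavour-diagonal matrix on quark variables with flavour-dependent blocks. [folklore] -/
def flavDiag (F : Fin Nf → Matrix (TorusSite 4 L × Fin 3 × Fin 4) (TorusSite 4 L × Fin 3 × Fin 4) ℂ) :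
    Matrix (QuarkVar Nf L) (QuarkVar Nf L) ℂ :=
  Matrix.of fun v w => if v.1 = w.1 then F v.1 v.2 w.2 else 0

/-- The degenerate-mass `N_f`-flavour Wilson–Dirac matrix on quark variables (the body of
`diracMatrix U (fun _ => m₀)` before enumeration). [folklore] -/
def diracQ (U : GaugeConfig 4 L (Matrix.specialUnitaryGroup (Fin 3) ℂ)) (m₀ : ℝ) : Matrix (QuarkVar Nf L) (QuarkVar Nf L) ℂ :=
  flavDiag fun _ => wilsonDirac (fundamentalRep (Fin 3)) U m₀ 1

/-- The twisted-mass matrix `iμ γ₅ τ³` on quark variables (verbatim the body of the statement's `Tw`). [folklore] -/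
def twistQ (f g : Fin Nf) (μl : ℝ) : Matrix (QuarkVar Nf L) (QuarkVar Nf L) ℂ :=
  Matrix.of fun v w : QuarkVar Nf L =>
    if v.1 = w.1 ∧ v.2.1 = w.2.1 ∧ v.2.2.1 = w.2.2.1 then
      (if v.1 = f then (1 : ℂ) else if v.1 = g then -1 else 0) * ((μl : ℂ) * Complex.I) *
        gammaFive v.2.2.2 w.2.2.2
    else 0

/-- The site–colour-diagonal spin matrix `iμ γ₅`. [folklore] -/
def twistBlock (μl : ℝ) : Matrix (TorusSite 4 L × Fin 3 × Fin 4) (TorusSite 4 L × Fin 3 × Fin 4) ℂ :=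
  Matrix.of fun p q => if p.1 = q.1 ∧ p.2.1 = q.2.1 then ((μl : ℂ) * Complex.I) * gammaFive p.2.2 q.2.2 else 0

/-- The rotation generator `B_b = b(x₀) τ² ⊗ 1_site ⊗ 1_colour ⊗ 1_spin` (time-sliced flavour rotation). [folklore] -/
def rotQ (f g : Fin Nf) (b : ZMod L → ℂ) : Matrix (QuarkVar Nf L) (QuarkVar Nf L) ℂ :=
  Matrix.of fun v w => if v.2 = w.2 then b (v.2.1 0) * tau2M f g v.1 w.1 else 0

/-- Kernel of the charged density `P¹(x) = ψ̄(x) γ₅ τ¹ ψ(x)` at the torus site `x`. [folklore] -/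
def densQ (f g : Fin Nf) (x : TorusSite 4 L) : Matrix (QuarkVar Nf L) (QuarkVar Nf L) ℂ :=
  ∑ f', ∑ g', tau1M f g f' g' • bilinKernel f' g' x x gammaFive 1

/-- Kernel of the conserved point-split current `Ṽ²₀(x)` (time component) at the torus site `x`. [folklore] -/
def currQ (f g : Fin Nf) (U : GaugeConfig 4 L (Matrix.specialUnitaryGroup (Fin 3) ℂ)) (x : TorusSite 4 L) :
    Matrix (QuarkVar Nf L) (QuarkVar Nf L) ℂ :=
  (1 / 2 : ℂ) •
    ((∑ f', ∑ g', tau2M f g f' g' •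
        bilinKernel f' g' (x + Pi.single 0 1) x (1 + euclideanGamma 0)
          (((U (x, 0))⁻¹ : Matrix.specialUnitaryGroup (Fin 3) ℂ) : Matrix (Fin 3) (Fin 3) ℂ)) -
      ∑ f', ∑ g', tau2M f g f' g' •
        bilinKernel f' g' x (x + Pi.single 0 1) (1 - euclideanGamma 0)
          ((U (x, 0) : Matrix.specialUnitaryGroup (Fin 3) ℂ) : Matrix (Fin 3) (Fin 3) ℂ))

/-- The indicator of the slab complement `R = {s₀ ≤ t ≤ 2S+1−s₀}` as a function of the time residue. [folklore] -/
def slabInd (S s₀ : ℕ) (z : ZMod (2 * S + 1)) : ℂ := if s₀ ≤ z.val ∧ z.val + s₀ ≤ 2 * S + 1 then 1 else 0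

end Defs

end SlabFluxWard

/-- **Registered sub-goal of file 1/4** (`stub_slabFluxBound_berezin`): the Schwinger–Dyson identity of the
Berezin integral for a traceless substitution derivation `δ_N` and a nilpotent weight exponent `q` commuting with
`δ_N q` — `∫ (δ_N X) e^q + ∫ X e^q (δ_N q) = 0`. [cite: Berezin1966, Ch. I §3] -/
theorem stub_slabFluxBound_berezin :
    ∀ {R : Type} [CommRing R] [Algebra ℚ R] {Γ : Type} [DecidableEq Γ] [Fintype Γ] [LinearOrder Γ] (N : Γ → Γ → R), ∑ X, N X X = 0 → ∀ {q : GrassmannAlgebra R Γ}, Commute q (SlabFluxWard.subOp N q) → IsNilpotent q → ∀ X : GrassmannAlgebra R Γ, GrassmannAlgebra.berezin R Γ (SlabFluxWard.subOp N X * grassmannExp q) + GrassmannAlgebra.berezin R Γ (X * (grassmannExp q * SlabFluxWard.subOp N q)) = 0 :=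
  fun N hN _ hq hn X => SlabFluxWard.berezin_subOp_mul_grassmannExp_add N hN hq hn X


end Summit.QuantumFields.QCD.Cruxes.ChiralCornerSoftness.TwistedRay
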